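import Summits.ResolutionOfSingularities.ResolutionOfSingularities.Theorems.FrobeniusClosingSteerSwitchBinaryEvenSatelliteRun
import Summits.ResolutionOfSingularities.ResolutionOfSingularities.Theorems.FrobeniusClosingSteerSatelliteStep
import HarnessLib

/-!
# hARᵒ H2 — H2ₘ GLUE: **a late switch of the tracked exceptional parameter yields an ON-AXIS BINARY A-stage** (run level, rational windows;
# Theses-free, def-free)

OURS (campaign `res-hironaka`, rung L ★L-G4, slot W4.1 · crux `Steer` (stmt-ResolutionOfSingularities-16345) · hARᵒ slot H2; P0 brief
`L/res-L0-w41-plan-1/P0-BRIEF-hARo.md` b66a17a38113b83f §«Remaining objects» 5 (GLUE); design res-type-062 g15 `H2-DESIGN.md` 7dac75913b6b98e3 §5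
«H2ₘ WITHOUT `AtMostOneOddDivisorAt`»; seat res-D-repro-2 g9, P0 main hand). The dichotomy over the run wrappers F3ʳᵘⁿ
`binaryAStage_of_oddSatellite_run` (p556495), F4ʳᵘⁿ `binaryAStage_of_evenSatellite_run`, Fβʳᵘⁿ `aStage_of_exceptional_twice_run` (p558172) and
tri-1's A6 `SatelliteStep.not_excParam_iff_div_not_isUnit`. Not a statement of the manuscript under review [claim: Hironaka2017, status:
under-review]; AI-produced, weaker than expert review.

* `exists_isVisitPair_left` — the visit BEFORE a point step (above an earlier point step).
* `exists_first_switch` — the FIRST visit pair `(j₁, j₂)` after `A` at which a stage predicate `Q` switches off (`Q` at every point step of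
  `[A, j₁]`, `¬ Q j₂`).
* `le_of_run` — members increase.
* `aStage_or_prev_aStage_of_run` — ALTERNATION `A B A B …`: if the tracked parameter `x` of a late A-stage `A` stays exceptional at every point
  step of `[A, j]`, then `j` or the visit before `j` is an A-stage (strong induction on `j` over Fβʳᵘⁿ).
* **`binaryAStage_of_lateSwitch_run`** — H2ₘ: `A ≥ N₁` a late A-stage with exceptional parameter `x`, `j′ > A` a point step at which `x` is no
  longer exceptional ⟹ some `i ∈ [A, j′]` (at which `x` is still exceptional) is an A-stage carrying the (H2)-datum of
  `ArithReductionLegality.arithSwitchClause_of_H2` with `u := x`; the late data are N4's height-one clause, Hγ, RATIONAL point windows (value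
  form) and the reduced order `d` at point steps `≥ N₁`, plus recurrence of point steps. (First switch `(j₁, j₂)`; the step after `j₂` is a
  satellite w.r.t. `x` by A6; alternation at `j₁`: case (α) F3ʳᵘⁿ at `(j₁, j₂, next)`, case (β) F4ʳᵘⁿ at `(prev, j₁, j₂, next)`.)
What remains for the word `ArithLeaf.LateSwitchBinaryAStageTwoN` (p559461): the switch EXISTS (from «no proper coarsening» + recurrence of
A-stages) and the non-rational windows (RULING 185f's residue word) — the next file.
[cite: Matsumura1987, Thm. 14.2] [folklore]
-/

noncomputable section

-- `Summit.<S>.<S>.…` duplicates the summit name by design (single-problem summit).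
set_option linter.dupNamespace false

open IsLocalRing MvPolynomial

namespace Summit.ResolutionOfSingularities.ResolutionOfSingularities.Theorems.SwitchingDichotomy.BinaryResidue

open Literature.AlgebraicGeometry.Resolution
open Summit.ResolutionOfSingularities.ResolutionOfSingularities.Theorems.SwitchingDichotomy.Words
  (HasClordAlongAt HasCleanedOrderAt HasReducedOrderAt IsOddDivisorAt NoOddDivisorAt IsAStageAt IsSteeredRun IsVisitPair IsPointStep)

variable {K : Type} [Field K] {O : ValuationSubring K} {R : ℕ → Subring K} {P : (i : ℕ) → Ideal (R i)} {t : K} {s : ℕ → K}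

/-- **The previous visit.** If `a < j` are point steps, there is a visit pair `(j⁻, j)` with `a ≤ j⁻`. [folklore] -/
theorem exists_isVisitPair_left {a j : ℕ} (haj : a < j) (hpa : IsPointStep R P a) (hpj : IsPointStep R P j) :
    ∃ j₀, a ≤ j₀ ∧ IsVisitPair R P j₀ j := by
  classical
  -- the largest point step below `j`: `j₀ = j - 1 - m₀`, `m₀` the least `m ≤ j - 1 - a` with `j - 1 - m` a point step
  have hex : ∃ m, m ≤ j - 1 - a ∧ IsPointStep R P (j - 1 - m) :=
    ⟨j - 1 - a, le_rfl, by rw [show j - 1 - (j - 1 - a) = a by omega]; exact hpa⟩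
  set m₀ := Nat.find hex with hm₀
  obtain ⟨hm₀le, hpt₀⟩ := Nat.find_spec hex
  refine ⟨j - 1 - m₀, by omega, by omega, hpt₀, hpj, fun k hk hkj hpk => ?_⟩
  have hlt : j - 1 - k < m₀ := by omega
  have hmin := Nat.find_min hex hlt
  exact hmin ⟨by omega, by rw [show j - 1 - (j - 1 - k) = k by omega]; exact hpk⟩

/-- **ALTERNATION (H2-DESIGN §5 (Fβ) corollary).** Steered run at `p = 2`, characteristic `2`, `R 0` dominated by `O`, regular members of dimension `4`;
late data: N4's height-one clause at point steps `≥ N₁`, Hγ at visit pairs `≥ N₁`, rational point windows `≥ N₁`, reduced order `d ≥ 3` at point steps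
`≥ N₁`. Let `A ≥ N₁` be an A-stage with exceptional parameter `x`, and `j ≥ A` a point step such that `x` is exceptional at EVERY point step of `[A, j]`.
Then `j` is an A-stage, or the visit before `j` is an A-stage. [folklore] -/
theorem aStage_or_prev_aStage_of_run [CharP K 2] (hrun : IsSteeredRun O R P t 2 s) (hR0 : SubringDominates (R 0) O.toSubring)
    (hreg : ∀ i, IsRegularLocalRing (R i)) (hdim : ∀ i, ringKrullDim (R i) = (4 : ℕ)) {N₁ : ℕ}
    (h1 : ∀ j, N₁ ≤ j → IsPointStep R P j → ∀ (hs' : s j ^ 2 ∈ R j) (Q : Ideal (R j)) [Q.IsPrime], Q.height = 1 →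
      ¬ SigmaTopLegality.IsSingPrime (R j) 2 ⟨s j ^ 2, hs'⟩ Q)
    (HΓ : ∀ j j' (x : K), N₁ ≤ j → IsVisitPair R P j j' →
      ((∃ h : x ∈ R j, (⟨x, h⟩ : R j) ∈ P j) ∧ x ≠ 0 ∧ ∀ y : R j, y ∈ P j → O.valuation (y : K) ≤ O.valuation x) →
      ∀ k, j < k → k < j' → ∃ hx : x ∈ R k, P k = Ideal.span {(⟨x, hx⟩ : R k)})
    (hrat : ∀ j j', N₁ ≤ j → IsVisitPair R P j j' → ∀ a ∈ R j', ∃ b ∈ R j, O.valuation (a - b) < 1)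
    {d : ℕ} (hd : 3 ≤ d) (hred : ∀ i, N₁ ≤ i → IsPointStep R P i → HasReducedOrderAt R s 2 i d)
    {A : ℕ} (hNA : N₁ ≤ A) (hA : IsAStageAt R P s 2 A d) {x : K}
    (hx : (∃ h : x ∈ R A, (⟨x, h⟩ : R A) ∈ P A) ∧ x ≠ 0 ∧ ∀ y : R A, y ∈ P A → O.valuation (y : K) ≤ O.valuation x) :
    ∀ j, A ≤ j → IsPointStep R P j →
      (∀ k, A ≤ k → k ≤ j → IsPointStep R P k →
        (∃ h : x ∈ R k, (⟨x, h⟩ : R k) ∈ P k) ∧ ∀ y : R k, y ∈ P k → O.valuation (y : K) ≤ O.valuation x) →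
      IsAStageAt R P s 2 j d ∨ ∃ j₀, A ≤ j₀ ∧ IsVisitPair R P j₀ j ∧ IsAStageAt R P s 2 j₀ d := by
  intro j
  induction j using Nat.strong_induction_on with
  | _ j ih =>
    intro hAj hpj hexc
    rcases hAj.eq_or_lt with rfl | hlt
    · exact Or.inl hA
    obtain ⟨j₀, hAj₀, hvp⟩ := exists_isVisitPair_left hlt hA.1 hpj
    have hj₀j : j₀ < j := hvp.1
    have hexc₀ : ∀ k, A ≤ k → k ≤ j₀ → IsPointStep R P k →
        (∃ h : x ∈ R k, (⟨x, h⟩ : R k) ∈ P k) ∧ ∀ y : R k, y ∈ P k → O.valuation (y : K) ≤ O.valuation x :=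
      fun k hk hk' hpk => hexc k hk (hk'.trans hj₀j.le) hpk
    rcases ih j₀ hj₀j hAj₀ hvp.2.1 hexc₀ with hA₀ | ⟨j₀₀, hAj₀₀, hvp₀, hA₀₀⟩
    · exact Or.inr ⟨j₀, hAj₀, hvp, hA₀⟩
    · left
      have hx₀₀ := hexc j₀₀ hAj₀₀ (hvp₀.1.le.trans hj₀j.le) hvp₀.2.1
      have hx₀ := hexc j₀ hAj₀ hj₀j.le hvp.2.1
      have hN₀₀ : N₁ ≤ j₀₀ := hNA.trans hAj₀₀
      have hN₀ : N₁ ≤ j₀ := hNA.trans hAj₀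
      exact aStage_of_exceptional_twice_run hrun hR0 hreg hdim hvp₀ hvp hd hA₀₀
        (hred j₀ hN₀ hvp.2.1) (hred j (hNA.trans hAj) hpj) ⟨hx₀₀.1, hx.2.1, hx₀₀.2⟩
        (HΓ j₀₀ j₀ x hN₀₀ hvp₀ ⟨hx₀₀.1, hx.2.1, hx₀₀.2⟩) ⟨hx₀.1, hx.2.1, hx₀.2⟩
        (HΓ j₀ j x hN₀ hvp ⟨hx₀.1, hx.2.1, hx₀.2⟩)
        (h1 j₀ hN₀ hvp.2.1) (h1 j (hNA.trans hAj) hpj) (hrat j₀₀ j₀ hN₀₀ hvp₀) (hrat j₀ j hN₀ hvp)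

/-- **The FIRST switch after `A`.** If `Q` holds at the point step `A` and fails at a later point step, there is a visit pair `(j₁, j₂)` with
`A ≤ j₁` such that `Q` holds at every point step of `[A, j₁]` and fails at `j₂`. [folklore] -/
theorem exists_first_switch (Q : ℕ → Prop) {A j' : ℕ} (hAj' : A < j') (hpA : IsPointStep R P A) (hpj' : IsPointStep R P j')
    (hQA : Q A) (hQj' : ¬ Q j') :
    ∃ j₁ j₂, A ≤ j₁ ∧ IsVisitPair R P j₁ j₂ ∧ (∀ k, A ≤ k → k ≤ j₁ → IsPointStep R P k → Q k) ∧ ¬ Q j₂ := by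
  classical
  have hex : ∃ k, A < k ∧ IsPointStep R P k ∧ ¬ Q k := ⟨j', hAj', hpj', hQj'⟩
  set j₂ := Nat.find hex with hj₂
  obtain ⟨hAj₂, hpt₂, hQ₂⟩ := Nat.find_spec hex
  obtain ⟨j₁, hAj₁, hvp⟩ := exists_isVisitPair_left hAj₂ hpA hpt₂
  refine ⟨j₁, j₂, hAj₁, hvp, fun k hAk hkj₁ hpk => ?_, hQ₂⟩
  rcases hAk.eq_or_lt with rfl | hlt
  · exact hQA
  · by_contra hQk
    exact Nat.find_min hex (show k < j₂ by have := hvp.1; omega) ⟨hlt, hpk, hQk⟩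

/-- Members of a steered run increase. [folklore] -/
theorem le_of_run {p : ℕ} (hrun : IsSteeredRun O R P t p s) {i j : ℕ} (hij : i ≤ j) : R i ≤ R j := by
  induction hij with
  | refl => exact le_rfl
  | step _ ih => exact ih.trans (VisitLawPointStep.isLocalBlowupAlong_of_run hrun _).isLocalBlowup.le

/-- **H2ₘ — a late switch of the tracked parameter yields an ON-AXIS BINARY A-stage** (run level, rational windows). Steered run at `p = 2`,
characteristic `2`, `R 0` dominated by `O`, regular members of dimension `4`, point steps recur; late data (`≥ N₁`): N4's height-one clause, Hγ,
rational point windows, reduced order `d ≥ 3`. Let `A ≥ N₁` be an A-stage with exceptional parameter `x` and `j′ > A` a point step at which `x` is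
NO LONGER exceptional. Then some `i ∈ [A, j′]` at which `x` is still exceptional is an A-stage carrying the (H2)-datum of
`ArithReductionLegality.arithSwitchClause_of_H2` with `u := x` (H2-DESIGN §5: first switch `(j₁, j₂)`; alternation; case (α) `j₁` an A-stage ⇒ F3ʳᵘⁿ at
`(j₁, j₂, next)`; case (β) the visit before `j₁` an A-stage ⇒ F4ʳᵘⁿ). [folklore] -/
theorem binaryAStage_of_lateSwitch_run [CharP K 2] (hrun : IsSteeredRun O R P t 2 s) (hR0 : SubringDominates (R 0) O.toSubring)
    (hreg : ∀ i, IsRegularLocalRing (R i)) (hdim : ∀ i, ringKrullDim (R i) = (4 : ℕ))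
    (hrec : ∀ i₀, ∃ i, i₀ ≤ i ∧ IsPointStep R P i) {N₁ : ℕ}
    (h1 : ∀ j, N₁ ≤ j → IsPointStep R P j → ∀ (hs' : s j ^ 2 ∈ R j) (Q : Ideal (R j)) [Q.IsPrime], Q.height = 1 →
      ¬ SigmaTopLegality.IsSingPrime (R j) 2 ⟨s j ^ 2, hs'⟩ Q)
    (HΓ : ∀ j j' (x : K), N₁ ≤ j → IsVisitPair R P j j' →
      ((∃ h : x ∈ R j, (⟨x, h⟩ : R j) ∈ P j) ∧ x ≠ 0 ∧ ∀ y : R j, y ∈ P j → O.valuation (y : K) ≤ O.valuation x) →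
      ∀ k, j < k → k < j' → ∃ hx : x ∈ R k, P k = Ideal.span {(⟨x, hx⟩ : R k)})
    (hrat : ∀ j j', N₁ ≤ j → IsVisitPair R P j j' → ∀ a ∈ R j', ∃ b ∈ R j, O.valuation (a - b) < 1)
    {d : ℕ} (hd : 3 ≤ d) (hred : ∀ i, N₁ ≤ i → IsPointStep R P i → HasReducedOrderAt R s 2 i d)
    {A : ℕ} (hNA : N₁ ≤ A) (hA : IsAStageAt R P s 2 A d) {x : K}
    (hx : (∃ h : x ∈ R A, (⟨x, h⟩ : R A) ∈ P A) ∧ x ≠ 0 ∧ ∀ y : R A, y ∈ P A → O.valuation (y : K) ≤ O.valuation x)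
    {j' : ℕ} (hAj' : A < j') (hpj' : IsPointStep R P j')
    (hnot : ¬ ((∃ h : x ∈ R j', (⟨x, h⟩ : R j') ∈ P j') ∧ ∀ y : R j', y ∈ P j' → O.valuation (y : K) ≤ O.valuation x)) :
    ∃ i, A ≤ i ∧ i ≤ j' ∧ IsAStageAt R P s 2 i d ∧
      ∃ (_ : IsLocalRing (R i)) (hs : s i ^ 2 ∈ R i) (g m₁ m₂ : R i) (Ψ : MvPolynomial (Fin 2) (R i)),
        IsRsopPart ![m₁, m₂] ∧ Ψ.IsHomogeneous d ∧
        (⟨s i ^ 2, hs⟩ : R i) - g ^ 2 - MvPolynomial.eval ![m₁, m₂] Ψ ∈ maximalIdeal (R i) ^ (d + 1) ∧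
        ((∃ hu : x ∈ R i, (⟨x, hu⟩ : R i) ∈ P i) ∧ x ≠ 0 ∧ ∀ y : R i, y ∈ P i → O.valuation (y : K) ≤ O.valuation x) ∧
        O.valuation (m₁ : K) < O.valuation x ∧ O.valuation (m₂ : K) < O.valuation x := by
  classical
  haveI hloc : ∀ i, IsLocalRing (R i) := fun i => VisitLawPointStep.isLocalRing_of_run hrun i
  have hdom : ∀ i, SubringDominates (R i) O.toSubring := fun i => VisitLawPointStep.subringDominates_of_run hrun hR0 i
  have hbl : ∀ i, IsLocalBlowupAlong O (R i) (P i) (R (i + 1)) := fun i => VisitLawPointStep.isLocalBlowupAlong_of_run hrun i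
  have hval : ∀ i (a : R i), a ∈ maximalIdeal (R i) ↔ O.valuation (a : K) < 1 := fun i =>
    (subringDominates_valuationSubring_iff (hdom i).1).mp (hdom i)
  -- the first switch `(j₁, j₂)` after `A`
  set Q : ℕ → Prop := fun k => (∃ h : x ∈ R k, (⟨x, h⟩ : R k) ∈ P k) ∧ ∀ y : R k, y ∈ P k → O.valuation (y : K) ≤ O.valuation x
    with hQ
  obtain ⟨j₁, j₂, hAj₁, hv₁, hexc, hQ₂⟩ := exists_first_switch (R := R) (P := P) Q hAj' hA.1 hpj' ⟨hx.1, hx.2.2⟩ hnot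
  have hj₂j' : j₂ ≤ j' := by
    by_contra hlt
    push Not at hlt
    -- `j'` is a point step strictly between... no: `j'` would lie in `(j₁, j₂)` or be `≤ j₁`
    rcases lt_or_ge j' j₁.succ with h | h
    · exact hnot (hexc j' hAj'.le (by omega) hpj')
    · exact hv₁.2.2.2 j' (by omega) hlt hpj'
  -- the next visit `N` after `j₂` and the parameter `x₁` of the step at `j₂`
  obtain ⟨N, hv₂⟩ := ArithReductionLegality.exists_isVisitPair hrec hv₁.2.2.1
  obtain ⟨x₁, g₁, hx₁, -, -⟩ := VisitLawPointStep.step_of_run hrun j₂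
  -- the satellite condition at `j₂`: `x ∈ P j₂` but not of maximal value ⇒ `x/x₁ ∈ 𝔪_{R (j₂+1)}` (A6)
  obtain ⟨instj₂, hPj₂⟩ := hv₁.2.2.1
  have hxj₂ : x ∈ R j₂ := le_of_run hrun (hAj₁.trans hv₁.1.le) hx.1.fst
  have hxv : O.valuation x < 1 := by
    obtain ⟨instA, hPA⟩ := hA.1
    obtain ⟨h, hP⟩ := hx.1
    exact (hval A ⟨x, h⟩).mp (hPA ▸ hP)
  have hxP : (⟨x, hxj₂⟩ : R j₂) ∈ P j₂ := by rw [hPj₂]; exact (hval j₂ ⟨x, hxj₂⟩).mpr hxv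
  have hnotmax : ¬ ∀ y : R j₂, y ∈ P j₂ → O.valuation (y : K) ≤ O.valuation x := fun h => hQ₂ ⟨⟨hxj₂, hxP⟩, h⟩
  have hsat : ∃ h : x / x₁ ∈ R (j₂ + 1), (⟨x / x₁, h⟩ : R (j₂ + 1)) ∈ maximalIdeal (R (j₂ + 1)) := by
    have hnu := (SatelliteStep.not_excParam_iff_div_not_isUnit (hdom (j₂ + 1)) (hbl j₂) hx₁ hxj₂ hxP hx.2.1).mp hnotmax
    exact ⟨_, (IsLocalRing.mem_maximalIdeal _).mpr hnu⟩
  -- late indices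
  have hN₁ : N₁ ≤ j₁ := hNA.trans hAj₁
  have hN₂ : N₁ ≤ j₂ := hN₁.trans hv₁.1.le
  have hNN : N₁ ≤ N := hN₂.trans hv₂.1.le
  have hxj₁ := hexc j₁ hAj₁ le_rfl hv₁.2.1
  have hxe₁ : (∃ h : x ∈ R j₁, (⟨x, h⟩ : R j₁) ∈ P j₁) ∧ x ≠ 0 ∧ ∀ y : R j₁, y ∈ P j₁ → O.valuation (y : K) ≤ O.valuation x :=
    ⟨hxj₁.1, hx.2.1, hxj₁.2⟩
  -- ALTERNATION at `j₁`
  rcases aStage_or_prev_aStage_of_run hrun hR0 hreg hdim h1 HΓ hrat hd hred hNA hA hx j₁ hAj₁ hv₁.2.1 hexc with hA₁ | ⟨j₀, hAj₀, hv₀, hA₀⟩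
  · -- case (α): `j₁` an A-stage ⇒ F3ʳᵘⁿ at `(j₁, j₂, N)`
    obtain ⟨hl, hs, g, m₁, m₂, Ψ, hrs, hΨ, hmem, hv1, hv2⟩ := binaryAStage_of_oddSatellite_run hrun hR0 hreg hdim hv₁ hv₂ hd hA₁
      (hred j₂ hN₂ hv₁.2.2.1) (hred N hNN hv₂.2.2.1) hxe₁ (HΓ j₁ j₂ x hN₁ hv₁ hxe₁) hx₁ (HΓ j₂ N x₁ hN₂ hv₂ hx₁) hsat
      (h1 j₂ hN₂ hv₁.2.2.1) (h1 N hNN hv₂.2.2.1) (hrat j₁ j₂ hN₁ hv₁) (hrat j₂ N hN₂ hv₂)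
    exact ⟨j₁, hAj₁, hv₁.1.le.trans hj₂j', hA₁, hl, hs, g, m₁, m₂, Ψ, hrs, hΨ, hmem, hxe₁, hv1, hv2⟩
  · -- case (β): the visit before `j₁` is an A-stage ⇒ F4ʳᵘⁿ at `(j₀, j₁, j₂, N)`
    have hN₀ : N₁ ≤ j₀ := hNA.trans hAj₀
    have hxj₀ := hexc j₀ hAj₀ hv₀.1.le hv₀.2.1
    have hxe₀ : (∃ h : x ∈ R j₀, (⟨x, h⟩ : R j₀) ∈ P j₀) ∧ x ≠ 0 ∧ ∀ y : R j₀, y ∈ P j₀ → O.valuation (y : K) ≤ O.valuation x :=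
      ⟨hxj₀.1, hx.2.1, hxj₀.2⟩
    obtain ⟨hl, hs, g, m₁, m₂, Ψ, hrs, hΨ, hmem, hv1, hv2⟩ := binaryAStage_of_evenSatellite_run hrun hR0 hreg hdim hv₀ hv₁ hv₂ hd hA₀
      (hred j₁ hN₁ hv₁.2.1) (hred j₂ hN₂ hv₁.2.2.1) (hred N hNN hv₂.2.2.1) hxe₀ (HΓ j₀ j₁ x hN₀ hv₀ hxe₀) hxe₁ (HΓ j₁ j₂ x hN₁ hv₁ hxe₁)
      hx₁ (HΓ j₂ N x₁ hN₂ hv₂ hx₁) hsat (h1 j₁ hN₁ hv₁.2.1) (h1 j₂ hN₂ hv₁.2.2.1) (h1 N hNN hv₂.2.2.1)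
      (hrat j₀ j₁ hN₀ hv₀) (hrat j₁ j₂ hN₁ hv₁) (hrat j₂ N hN₂ hv₂)
    exact ⟨j₀, hAj₀, (hv₀.1.le.trans hv₁.1.le).trans hj₂j', hA₀, hl, hs, g, m₁, m₂, Ψ, hrs, hΨ, hmem, hxe₀, hv1, hv2⟩

/-- **A switch AT ANY point step** (S4 sharpened): along a steered run whose point steps recur and for which the weak persistence clause FAILS
(«no proper coarsening», the (Par-S) binder verbatim), EVERY point step `j` has an exceptional parameter `x` that is no longer exceptional at some
later point step (else all of them persist and `SwitchRecurrence.weakPersistence_of_persistentParam` contradicts the clause).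
[cite: HeinzerEtAl2015, Remark 2.4] [folklore] -/
theorem exists_switch_at_of_not_persistent {p : ℕ} (hrun : IsSteeredRun O R P t p s) (hR0 : SubringDominates (R 0) O.toSubring)
    (hrec : ∀ i₀, ∃ i, i₀ ≤ i ∧ IsPointStep R P i)
    (hnp : ¬ ∃ i₀ : ℕ, ∃ x : K, x ≠ 0 ∧ x ∈ O ∧ O.valuation x < 1 ∧
      ∀ i, i₀ ≤ i → ∀ y ∈ R i, O.valuation y < 1 → ∃ j, i < j ∧ y / x ∈ R j)
    {j : ℕ} (hpt : IsPointStep R P j) :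
    ∃ x : K, ((∃ hx : x ∈ R j, (⟨x, hx⟩ : R j) ∈ P j) ∧ x ≠ 0 ∧ ∀ y : R j, y ∈ P j → O.valuation (y : K) ≤ O.valuation x) ∧
      ∃ j', j < j' ∧ IsPointStep R P j' ∧
        ¬ ((∃ hx : x ∈ R j', (⟨x, hx⟩ : R j') ∈ P j') ∧ ∀ y : R j', y ∈ P j' → O.valuation (y : K) ≤ O.valuation x) := by
  have hbl : ∀ i, IsLocalBlowupAlong O (R i) (P i) (R (i + 1)) := fun i => VisitLawPointStep.isLocalBlowupAlong_of_run hrun i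
  have hRO : ∀ i, R i ≤ O.toSubring := OddBranchPersistence.le_valuationSubring_of_seq hbl
  have hdom : ∀ i, SubringDominates (R i) O.toSubring := fun i => VisitLawPointStep.subringDominates_of_run hrun hR0 i
  by_contra hcon
  push Not at hcon
  obtain ⟨x, hxP, hx0, hmax⟩ := SwitchRecurrence.exists_excParam_of_isLocalBlowupAlong (hbl j)
  have hlater := hcon x ⟨hxP, hx0, hmax⟩
  apply hnp
  obtain ⟨hxR, hxP'⟩ := hxP
  have hxO : x ∈ O := hRO j hxR
  have hvx : O.valuation x < 1 := by
    obtain ⟨hloc, hP⟩ := hpt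
    have hm : (⟨x, hxR⟩ : R j) ∈ maximalIdeal (R j) := hP ▸ hxP'
    exact SwitchRecurrence.valuation_lt_one_of_not_isUnit (hdom j) ⟨x, hxR⟩ ((mem_maximalIdeal _).mp hm)
  refine ⟨j, x, hx0, hxO, hvx, SwitchRecurrence.weakPersistence_of_persistentParam hbl hrec hx0 fun j' hj hptj => ?_⟩
  rcases hj.lt_or_eq with hlt | heq
  · exact hlater j' hlt hptj
  · subst heq
    exact ⟨⟨hxR, hxP'⟩, hmax⟩

/-- **H2′ (rational windows): beyond every stage an ON-AXIS BINARY A-stage.** Steered run at `p = 2`, characteristic `2`, `R 0` dominated by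
`O`, regular members of dimension `4`, the weak persistence clause FAILS («no proper coarsening»), A-stages of reduced order `d ≥ 3` recur, and
late (`≥ N₁`): N4's height-one clause, Hγ, RATIONAL point windows, reduced order `d` at point steps. Then beyond every stage there is an
A-stage `i` with the (H2)-datum (`u` an exceptional parameter of the step at `i`). (= the conclusion of strat-2's word
`ArithLeaf.LateSwitchBinaryAStageTwoN` p559461 under the extra RATIONALITY binder; the residually non-rational windows are the next file.)
[folklore] -/
theorem lateBinaryAStage_of_run [CharP K 2] (hrun : IsSteeredRun O R P t 2 s) (hR0 : SubringDominates (R 0) O.toSubring)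
    (hreg : ∀ i, IsRegularLocalRing (R i)) (hdim : ∀ i, ringKrullDim (R i) = (4 : ℕ))
    (hnp : ¬ ∃ i₀ : ℕ, ∃ x : K, x ≠ 0 ∧ x ∈ O ∧ O.valuation x < 1 ∧
      ∀ i, i₀ ≤ i → ∀ y ∈ R i, O.valuation y < 1 → ∃ j, i < j ∧ y / x ∈ R j)
    {N₁ : ℕ}
    (h1 : ∀ j, N₁ ≤ j → IsPointStep R P j → ∀ (hs' : s j ^ 2 ∈ R j) (Q : Ideal (R j)) [Q.IsPrime], Q.height = 1 →
      ¬ SigmaTopLegality.IsSingPrime (R j) 2 ⟨s j ^ 2, hs'⟩ Q)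
    (HΓ : ∀ j j' (x : K), N₁ ≤ j → IsVisitPair R P j j' →
      ((∃ h : x ∈ R j, (⟨x, h⟩ : R j) ∈ P j) ∧ x ≠ 0 ∧ ∀ y : R j, y ∈ P j → O.valuation (y : K) ≤ O.valuation x) →
      ∀ k, j < k → k < j' → ∃ hx : x ∈ R k, P k = Ideal.span {(⟨x, hx⟩ : R k)})
    (hrat : ∀ j j', N₁ ≤ j → IsVisitPair R P j j' → ∀ a ∈ R j', ∃ b ∈ R j, O.valuation (a - b) < 1)
    {d : ℕ} (hd : 3 ≤ d) (hred : ∀ i, N₁ ≤ i → IsPointStep R P i → HasReducedOrderAt R s 2 i d)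
    (hA : ∀ i₀, ∃ i, i₀ ≤ i ∧ IsAStageAt R P s 2 i d) :
    ∀ i₀ : ℕ, ∃ i, i₀ ≤ i ∧ IsAStageAt R P s 2 i d ∧
      ∃ (_ : IsLocalRing (R i)) (hs : s i ^ 2 ∈ R i) (g m₁ m₂ : R i) (Ψ : MvPolynomial (Fin 2) (R i)) (u : K),
        IsRsopPart ![m₁, m₂] ∧ Ψ.IsHomogeneous d ∧
        (⟨s i ^ 2, hs⟩ : R i) - g ^ 2 - MvPolynomial.eval ![m₁, m₂] Ψ ∈ maximalIdeal (R i) ^ (d + 1) ∧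
        ((∃ hu : u ∈ R i, (⟨u, hu⟩ : R i) ∈ P i) ∧ u ≠ 0 ∧ ∀ y : R i, y ∈ P i → O.valuation (y : K) ≤ O.valuation u) ∧
        O.valuation (m₁ : K) < O.valuation u ∧ O.valuation (m₂ : K) < O.valuation u := by
  intro i₀
  have hrec : ∀ i₀, ∃ i, i₀ ≤ i ∧ IsPointStep R P i := fun i₀ => by
    obtain ⟨i, hi, hAi⟩ := hA i₀
    exact ⟨i, hi, hAi.1⟩
  obtain ⟨A, hA₀, hAst⟩ := hA (max i₀ N₁)
  have hNA : N₁ ≤ A := (le_max_right _ _).trans hA₀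
  have hiA : i₀ ≤ A := (le_max_left _ _).trans hA₀
  obtain ⟨x, hx, j', hAj', hpj', hnot⟩ := exists_switch_at_of_not_persistent hrun hR0 hrec hnp hAst.1
  obtain ⟨i, hAi, -, hAi', hl, hs, g, m₁, m₂, Ψ, hrs, hΨ, hmem, hxe, hv1, hv2⟩ :=
    binaryAStage_of_lateSwitch_run hrun hR0 hreg hdim hrec h1 HΓ hrat hd hred hNA hAst hx hAj' hpj' hnot
  exact ⟨i, hiA.trans hAi, hAi', hl, hs, g, m₁, m₂, Ψ, x, hrs, hΨ, hmem, hxe, hv1, hv2⟩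

end Summit.ResolutionOfSingularities.ResolutionOfSingularities.Theorems.SwitchingDichotomy.BinaryResidue

end
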